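import Mathlib
import HarnessLib
import HarnessLib.Audit
import Summits.PneNP.Statement
import Literature.Computability.Complexity.Nondeterministic
import Literature.Computability.Complexity.Classes
import Literature.Computability.MetaComplexity.NaturalProofs
import Literature.Computability.Learning.PAC
import Literature.Computability.Complexity.CNF
import HarnessLib.Audit.Status.Attr

/-!
Route: Learning

DORMANT since 2026-08-21T23:52:34Z (reconciler: no traction for 5 d (last activity item-proof-filed at 2026-08-16T23:24:00Z); parked, not closed — `ledger route dormant route-PneNP-Learning --off` to reactivate) — unstaffed, not closed; items shared with open routes are served there. `ledger route dormant <id> --off` reactivates.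

# Route PneNP/Learning — "polynomial-size circuits cannot be PAC-learned" (computational learning
theory)

## Thesis X (it suffices to show)
Words: for some k, the concept class SIZE[n^k] (Boolean functions on {0,1}ⁿ computed by B₂-circuits
of size ≤ n^k) is not
polynomially PAC-predictable — no oracle algorithm with budgets polynomial in n + ⌈1/ε⌉ + ⌈1/δ⌉,
given i.i.d. labelled
examples from an arbitrary distribution (random examples only, no membership queries), outputs with
probability ≥ 1 − δ a
polynomially evaluatable hypothesis of error ≤ ε (improper learning allowed). Typed over the audited
PAC model
Literature.Computability.Learning.PolyPACPredictable (item LearningThesis = the target; no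
definition request left open).
Lean: `∃ k : ℕ, ¬ Literature.Computability.Learning.PolyPACPredictable
Literature.Computability.Learning.allDistributions false
(Literature.Computability.Learning.sizeClass Literature.Computability.Complexity.B2 (fun n => n ^
k))`

## Assembly X → PneNP
Contrapositive Occam: if Classes.P = Nondeterministic.NP then a size-n^k circuit consistent with a
labelled sample is found in
polynomial time (NP search made deterministic by search-to-decision) and by Occam's razor
[BlumerEhrenfeuchtHausslerWarmuth1989,
Thm 2.1(ii)(a); PittValiant1988, §1] every SIZE[n^k] is polynomially PAC-predictable — item
LearningOccam (KNOWN). So X gives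
Classes.P ≠ Nondeterministic.NP and, through the model bridges P_bool_eq / NP_bool_eq / P ⊆ NP (all
PROVED in the tree), Cook's
PneNP. Item Assembly (rev 3, restated) := LearningOccam → LearningThesis → PneNP — hypotheses are
listed items only; provable now
in a Theorems file by `Literature.Learning.learning_assembly P_bool_eq_holds NP_bool_eq_holds
P_subset_NP_holds` (pre-checked,
lean check rc 0; candidate file attached as evidence). Deciding theorem (pure logic over three
listed items):
`closes (hX : LearningThesis) (hOccam : LearningOccam) (hA : Assembly) : _root_.PneNP := hA hOccam
hX`. The bridges live inside
the Assembly ITEM, proved in Theorems/, so that the route file imports neither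
Complexity.ClayProblem (home of the open
conjecture NPNotSubsetPPoly) nor Cryptography.OneWayFunctions (OWFExist and its three open
variants): the route's cone is proved
down to Mathlib, its own items excepted.

Rationale: WHY THIS LINE. Valiant's model [Valiant1984] is an independent axis on which P ≠ NP casts a shadow:
OWF ⇒ PRF ⇒ SIZE[n^k] is not learnable even with membership queries [GoldreichGoldwasserMicali1986,
Thm 4; KearnsValiant1994], while P = NP ⇒ every SIZE[n^k] is learnable by Occam + search-to-decision
[BlumerEhrenfeuchtHausslerWarmuth1989, Thm 2.1; PittValiant1988, §1]; so worst-case learning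
hardness X sits between OWF and P ≠ NP and implies the summit.
Carmosino–Impagliazzo–Kabanets–Kolokolova [CarmosinoImpagliazzoKabanetsKolokolova2016, Thm 1.1–1.3,
5.1] and Oliveira–Santhanam [OliveiraSanthanam2017 = arXiv:1611.01190, Lemma 5, Thm 8] give the
dictionary "natural property useful against Λ ⇔ Λ learnable (uniform distribution, membership
queries, quasi-polynomial slack)" and the learning ⇒ lower-bound transfer theorems; the route asks
whether learning-theoretic structure (Occam compression, boosting, SQ dimension) can prove X
outright, with Valiant's DNF question as its concrete face. Imported area: computational learning
theory / VC–Occam theory; no physical or spectral analogy is used (none carries an implication to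
X). What it does that the other PneNP routes do not: the target is a UNIFORM algorithmic
impossibility (no polynomial-time learner) — weaker than NP ⊄ P/poly, still implying P ≠ NP — stated
over an audited PAC model. Rev 3 (route-repair 2026-08-15): the former crux "X → OWFExist"
(stmt-PneNP-0417) is dropped from THIS route — it is a consequence of X, not a step towards PneNP,
its conclusion is the thesis of route MetaCplx, and it pulled the open conjectures OWFExist /
WeakOWFExist / IOOWFExist / NonuniformOWFExist into the cone; the Assembly item (stmt-PneNP-0415) is
RESTATED from "P_bool_eq → NP_bool_eq → P_subset_NP → Occam → X → PneNP" (Literature facts as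
hypotheses = glue.extra-hypothesis) to LearningOccam → LearningThesis → PneNP (bridges discharged
inside its proof), and the deciding theorem `closes` is supplied.
RANKED CRUXES. #2 LearningDnfHard — for some k the n^k-term DNF over n variables are not
polynomially PAC-predictable (distribution-free, improper, random examples): Valiant's 1984 open
question; implies X via LearningDnfHardImpliesThesis (why it might fail: a polynomial-time
distribution-free DNF learner may exist — the record 2^{Õ(n^{1/3})} of Klivans–Servedio,
doi:10.1016/j.jcss.2003.07.007, is tight only for the polynomial-threshold-function method, and
improper hardness is known only under average-case assumptions [DanielyShalevShwartz2016, Thm 1.3],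
NP-hardness being blocked by Applebaum–Barak–Xiao doi:10.1109/focs.2008.35; sources Valiant1984,
PittValiant1988, DanielyShalevShwartz2016, doi:10.1016/j.jcss.2003.07.007,
doi:10.1109/focs.2008.35). #4 LearningNoNaturalProperty — no combinatorial property of Boolean
functions is P/poly-natural and useful against P/poly (the Razborov–Rudich conclusion, asserted
unconditionally); implies X via LearningNoNaturalPropertyImpliesThesis, because a polynomial-time
PAC learner of every SIZE[n^k] IS such a property [OliveiraSanthanam2017, Lemma 5 and Thm 8;
CarmosinoImpagliazzoKabanetsKolokolova2016, §1.1] (why it might fail: false iff a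
P/poly-constructive large property is useful against all SIZE[n^k], e.g. if MCSP at threshold n^{log
n} ∈ P/poly [AroraBarakCC2009, Ex. 23.2]; known only from 2^{n^ε}-hard PRGs [RazborovRudich1997, Thm
4.1]; sources RazborovRudich1997, CarmosinoImpagliazzoKabanetsKolokolova2016, AroraBarakCC2009,
OliveiraSanthanam2017). Support / assembly (unranked, do not drive staffing): LearningOccam (KNOWN:
Occam under P = NP), Assembly (restated, provable now: LearningOccam → LearningThesis → PneNP by
Literature.Learning.learning_assembly with P_bool_eq_holds, NP_bool_eq_holds, P_subset_NP_holds;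
candidate proof attached as evidence), LearningDnfHardImpliesThesis (folklore: n^k-term DNF ⊆
SIZE[n^{k+2}] for n ≥ n₀, PolyPACPredictable antitone in the class),
LearningNoNaturalPropertyImpliesThesis (learners ⇒ natural property),
LearningNoNaturalPropertyImpliesPNeNP (sanity: #4 sits above P ≠ NP by Shannon counting + MCSP-slice
∈ NP [RazborovRudich1997, §2]).
KILL CRITERIA. ¬X (a polynomial-time PAC learner for every SIZE[n^k]) closes the route outright —
close --reason refuted:LearningThesis — and would kill every PRF/OWF with it (not expected).
¬LearningDnfHard (a polynomial-time distribution-free DNF learner; a celebrated theorem if found)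
forces the pivot to #4 as the spine; ¬LearningNoNaturalProperty (an explicit P/poly-natural property
useful against P/poly, i.e. a natural proof against P/poly) ⇒ drop #4 and keep X via #2. Proved
elsewhere that moots the route: OWFExist (thesis of route MetaCplx) implies X by GGM86 + KV94 and
already implies PneNP there.
NOT DECOMPOSED YET. Proper vs improper, membership queries vs random examples, uniform vs
distribution-free variants of X (the items fix distribution-free, improper, random examples);
SQ-dimension and boosting lemmas; agnostic variants; which DNF size measure; the packaging of
sampler + FP consistency search as ONE polynomial-time OracleAlg inside LearningOccam; the
finitely-many-small-n patch inside LearningDnfHardImpliesThesis. Deliberately OUTSIDE the route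
since rev 3: the learning ⇒ cryptography direction (X → OWFExist; posed in OliveiraSanthanam2017
§1.2.2, non-relativizable by Hirahara–Nanashima doi:10.1109/focs52979.2021.00078) — it belongs to
route MetaCplx's side of the lower-bounds / crypto / derandomization / learning square.
CHEAPEST FALSIFIER. Two cheap checks, refuters first: (i) a literature lookup for a polynomial-time
distribution-free improper PAC learner of polynomial-size DNF (kills #2; state of the art for random
examples 2^{Õ(n^{1/3})}, doi:10.1016/j.jcss.2003.07.007; 2023+ arXiv sweep 2026-08-15 (`lit search …
--source arxiv`, 4 hits; OpenAlex/S2 rate-limited that day): arXiv:2505.18839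
(Alman–Nadimpalli–Patel–Servedio 2025) learns size-s DNF with equal-size terms distribution-free in
quasipoly(n, s) time but WITH membership queries, arXiv:2507.20336 is exact learning with MQ + EQ,
arXiv:2301.08486 (Bshouty 2023) gives superpolynomial lower bounds for monotone classes in query
models — none touches polynomial-time random-examples learning of poly-size DNF, so #2 stands; the
OpenAlex/S2 half of the sweep is still owed); (ii) a typing sanity check of the model: does
PolyPACPredictable allDistributions false (sizeClass B2 (n ↦ n^k)) admit a degenerate learner
through an encoding corner (n = 0 or 1, hypothesis-evaluator budget, empty concept class at small
n)? A `lean check` of a brute-force learner at fixed n against the definition settles (ii) quickly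
and would refute LearningThesis as misstated, not the line.
SOURCES. Valiant1984; arXiv:2505.18839; arXiv:2507.20336; arXiv:2301.08486; PittValiant1988;
BlumerEhrenfeuchtHausslerWarmuth1989; KearnsValiant1994; KearnsVazirani1994;
GoldreichGoldwasserMicali1986; CarmosinoImpagliazzoKabanetsKolokolova2016; OliveiraSanthanam2017
(arXiv:1611.01190); RazborovRudich1997; AroraBarakCC2009; DanielyShalevShwartz2016; CookClay2006;
doi:10.1016/j.jcss.2003.07.007 (Klivans–Servedio 2004); doi:10.1109/focs52979.2021.00078
(Hirahara–Nanashima 2021); doi:10.1109/focs.2008.35 (Applebaum–Barak–Xiao 2008); tree: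
Literature.Learning.learning_assembly and pneNP_of_P_ne_NP
(Summits/PneNP/PneNP/Theorems/LearningAssembly.lean),
Literature.Computability.Complexity.P_bool_eq_holds, NP_bool_eq_holds, P_subset_NP_holds.
DEFINITION REQUESTS. None open: the PAC model landed as
Literature.Computability.Learning.PolyPACPredictable / allDistributions / sizeClass
(Literature/Computability/Learning/PAC.lean).

Novelty: NOVELTY (retriage planner 2026-08-14, item names updated by the route-repair planner 2026-08-15 — no
new claim; searched before claiming: `lit search` ×3 (ABX08, Hirahara–Nanashima 2021,
Klivans–Servedio), `lit galaxy search` ×5 incl. one --mode intelligent (found Goldberg CCC 2025,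
Karchmer ECCC 2023/085), `lit frontier PneNP --since 2020`, reads of held arXiv:2507.13222,
doi:10.1007/s00037-024-00260-5, doi:10.1016/j.tcs.2007.05.018, OliveiraSanthanam2017).
Nearest prior art. The thesis X ("for some k, SIZE[n^k] is not polynomial-time PAC-predictable,
distribution-free, random examples, improper") is Valiant's own cryptographic-hardness-of-learning
thesis [Valiant1984, pp. 437, 439] [PittValiant1988, pp. 968–970], with its classical web X ⇐ OWF
[GoldreichGoldwasserMicali1986, Thm 4 + Cor.] [KearnsValiant1994] and P = NP ⇒ ¬X by Occam +
search-to-decision [BlumerEhrenfeuchtHausslerWarmuth1989, Thm 2.1(ii)(a), Cor 3.1.3]. The learning /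
natural-proofs / PRF dictionary behind LearningNoNaturalProperty /
LearningNoNaturalPropertyImpliesThesis / LearningNoNaturalPropertyImpliesPNeNP is
[CarmosinoImpagliazzoKabanetsKolokolova2016, Thm 5.1 and §1.1] [OliveiraSanthanam2017 =
arXiv:1611.01190, Thms 2–3] [RazborovRudich1997, Thm 4.1]. The worst-case-learning ⇒ OWF question
(former crux X → OWFExist, dropped from this route in rev 3 and left to route MetaCplx) is posed
explicitly in [OliveiraSanthanam2017, §1.2.2] and separated from relativizing techniques by
Hirahara–Nanashima, FOCS 2  [refs: 10.1007/s00037-024-00260-5, 10.1016/j.tcs.2007.05.018, 10.1109/focs52979.2021.00078, 10.4230/LIPIcs.CCC.2025.34, 10.1109/focs.2008.35, 10.1016/j.jcss.2003.07.007, 2507.13222, 1611.01190, doi:10.1007/s00037-024-00260-5, doi:10.1016/j.tcs.2007.05.018, doi:10.1109/focs52979.2021.00078, doi:10.4230/LIPIcs.CCC.2025.34, doi:10.1109/focs.2008.35, doi:10.1016/j.jcss.2003.07.007, OliveiraSanthanam2017, Val]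

Barriers (technique_class: learning-hardness, natural-proofs, crypto-vs-learning): - technique_class: learning-hardness, natural-proofs, crypto-vs-learning
- Literature.Barriers.PneNP.Relativization: APPLIES, not evaded (the same holds for
BoundedRelativization and Algebrization, next two lines). The assembly X → P ≠ NP (items
LearningOccam + Assembly: Occam + search-to-decision under P = NP, then the model bridges;
Literature.Learning.learning_assembly) relativizes, so a relativizing / PSPACE-relativizing /
algebrizing proof of X would be one of P ≠ NP (Relativization.not_relativizes_P_ne_NP,
BoundedRelativization.not_relativizes_P_ne_NP); concretely X fails relative to any oracle O with P^O
= NP^O, since O-aided learners find consistent size-n^k circuits. The learning ⇒ OWF direction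
(former crux X → OWFExist, dropped in rev 3, MetaCplx's business) is separately non-relativizable:
Hirahara–Nanashima's relativized Heuristica (doi:10.1109/focs52979.2021.00078) has DistNP ⊆ AvgP,
hence no OWF, while P/poly is not PAC-learnable. The bet, stated honestly: only a non-black-box use
of learning-theoretic structure (CIKK-style reconstruction, meta-complexity as in
Hirahara2022PartialMCSP) could prove X, and no such argument for X is in hand.
- Literature.Barriers.PneNP.BoundedRelativization: APPLIES exactly as Relativization above
(BoundedRelativization.not_relativizes_P_ne_NP): a PSPACE-relativizing proof of X would be a
PSPACE-relativizing proof of P ≠ NP; not evaded.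
- Literature.Barriers.PneNP.Algebrization: APPLIES as above — the Occam assembly algebrizes (an

Novelty grade: known — REVIEW refuter 2026-08-15 rev6. VERDICT: KEEP OPEN. 8/8 items elaborate (W.lean rc0), all stamped with briefings; Assembly 10728 provable now (candidate proof re-verified, axioms clean); PAC model WITNESSED non-vacuous (Sanity.lean evidence on 1156: constant class PolyPACPredictable, sorry-free); cr (refuter refuter-rreview1-PneNP-Learning-6b0ae876-0, 2026-08-15T18:27:19Z; prior: Valiant1984, PittValiant1988, BlumerEhrenfeuchtHausslerWarmuth1989, GoldreichGoldwasserMicali1986, KearnsValiant1994, RazborovRudich1997, CarmosinoImpagliazzoKabanetsKolokolova2016, arXiv:1611.01190, arXiv:1404.3378, doi:10.1016/j.jcss.2003.07.007, doi:10.1109/focs.2008.35, doi:10.1109/focs52979.2021.00078, arXiv:2603.08700, arXiv:2505.18839, arXiv:2506.01075)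

History (route lifecycle, newest last):
- 2026-08-15T16:22:27Z · rev 3: restated Assembly (stmt-PneNP-0415) — route-repair rev 3 (glue + cone guardrail + schema): drop stmt-PneNP-0417 LearningHardnessImpliesOwf (consequence of X, not a step to PneNP; its conclusion OWFE (planner-rbadge-PneNP-Learning-6b0ae876-g2-0)
- 2026-08-15T16:22:27Z · rev 3: dropped stmt-PneNP-0417 — route-repair rev 3 (glue + cone guardrail + schema): drop stmt-PneNP-0417 LearningHardnessImpliesOwf (consequence of X, not a step to PneNP; its conclusion OWFE (planner-rbadge-PneNP-Learning-6b0ae876-g2-0)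
- 2026-08-16T04:14:20Z · AUTO-CRUX (backfill): LearningThesis — hypotheses of the deciding theorem that nothing in the route derives are cruxes (operator:999:1085951)
- 2026-08-21T23:52:34Z · DORMANT — reconciler: no traction for 5 d (last activity item-proof-filed at 2026-08-16T23:24:00Z); parked, not closed — `ledger route dormant route-PneNP-Learning --off` (operator:999:3246611)

sub-problem: PneNP · status: dormant · opened planner-PneNP-Survey-0 2026-08-13T06:33:40Z · rev 6 · ledger route-PneNP-Learning
GENERATED by the gate from the ledger (D-0016/17). Provers cite these decls: `theorem foo : Summit.PneNP.PneNP.Theses.Learning.<Decl> := …` in Summits/PneNP/PneNP/Theorems/<Name>.lean.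
-/

namespace Summit.PneNP.PneNP.Theses.Learning

open scoped BigOperators Topology Manifold Classical MeasureTheory ProbabilityTheory Matrix InnerProductSpace ComplexConjugate ContinuousMap
open Filter Set Function TopologicalSpace MeasureTheory

attribute [summit_statement] _root_.PneNP

open Literature.PNP

/-- item stmt-PneNP-0414 · crux (kind.auto-crux: conjecture-grade) · rank 0 · open · by planner
why it might fail: ¬X iff every SIZE[n^k] is poly-time PAC-predictable, e.g. if P = NP (Valiant1984 p.439; BEHW89 Cor 3.1.3), which kills all PRFs/OWFs (GGM86 Thm 4); X is believed, but unconditional learning hardness is known only from BPE/poly up (doi:10.1007/s00037-024-00260-5 Thm 1.1); X ⇒ P≠NP.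
sources: Valiant1984, PittValiant1988, BlumerEhrenfeuchtHausslerWarmuth1989, GoldreichGoldwasserMicali1986, KearnsValiant1994, doi:10.1007/s00037-024-00260-5
Route thesis of PneNP/Learning (informal until PACLearnable lands). There is k such that no
randomized algorithm A, given n, ε, δ and i.i.d. labelled examples (x, f(x)) with x ∼ D (D an
arbitrary distribution on {0,1}ⁿ, f : {0,1}ⁿ → {0,1} computed by a B₂-circuit of size ≤ n^k), runs
in time poly(n, 1/ε, 1/δ) and outputs with probability ≥ 1 − δ a hypothesis h (a circuit, evaluated
in time poly in its size) with Pr_{x∼D}[h(x) ≠ f(x)] ≤ ε. Improper learning allowed; random examples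
only. [Valiant1984 (bib key missing); KearnsValiant1994 (bib key missing)] NEEDS DEFINITION:
PACLearnable. [sources: Valiant1984; KearnsValiant1994] [route PneNP/Learning, rank 0] -/
@[route_item "route-PneNP-Learning", crux]
def LearningThesis : Prop :=
  ∃ k : ℕ, ¬ Literature.Computability.Learning.PolyPACPredictable Literature.Computability.Learning.allDistributions false (Literature.Computability.Learning.sizeClass Literature.Computability.Complexity.B2 (fun n => n ^ k))

/-- item stmt-PneNP-0416 · crux · rank 2 · open · by planner
why it might fail: A poly-time distribution-free DNF learner may exist: record 2^{Õ(n^{1/3})} (doi:10.1016/j.jcss.2003.07.007); with membership queries already quasipoly for equal-size terms (arXiv:2505.18839, 2025); improper hardness known only under average-case assumptions (DanielyShalevShwartz2016 Thm 1.3; ABX08).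
sources: Valiant1984, DanielyShalevShwartz2016, doi:10.1016/j.jcss.2003.07.007, doi:10.1016/j.tcs.2007.05.018, doi:10.1109/focs.2008.35, PittValiant1988
Hardest / most informative crux. For some k, the class of n-variable DNF with ≤ n^k terms
(Literature.Computability.Complexity.CNF read via CNF.evalDNF) is not PAC-learnable
(distribution-free, improper, random examples) in time poly(n, 1/ε, 1/δ). Implies the thesis
(DNF_{n^k} ⊆ SIZE[n^{k+1}] up to constants). Record algorithm: 2^{Õ(n^{1/3})} via polynomial
threshold functions [KlivansServedio2004 (bib key missing)]; conditional hardness from hardness of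
refuting random K-SAT [arXiv:1404.3378, Thm 1.1] — ties to route Feige. NEEDS DEFINITION:
PACLearnable. NEEDS DEFINITION: PACLearnable. [sources: Valiant1984; arXiv:1404.3378;
KlivansServedio2004] [route PneNP/Learning, rank 2] -/
@[route_item "route-PneNP-Learning"]
def LearningDnfHard : Prop :=
  ∃ k : ℕ, ¬ Literature.Computability.Learning.PolyPACPredictable Literature.Computability.Learning.allDistributions false (fun n => {f : (Fin n → Bool) → Bool | ∃ φ : Literature.Computability.Complexity.CNF (Fin n), φ.length ≤ n ^ k ∧ ∀ x, Literature.Computability.Complexity.CNF.evalDNF φ x = f x})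

/-- item stmt-PneNP-0418 · crux · rank 4 · open · by planner
why it might fail: False iff a P/poly-constructive large property is useful vs all SIZE[n^k]: e.g. if MCSP at threshold n^{log n} ∈ P/poly (AroraBarak2009 Ex 23.2 turns natural) ⇔ (CIKK16 Thm 5.1) P/poly learnable in 2^{n^{o(1)}} time, uniform+MQ; known only ⇐ 2^{k^ε}-hard PRGs (RR97 Thm 4.1; not_exists_naturalProof).
sources: RazborovRudich1997, CarmosinoImpagliazzoKabanetsKolokolova2016, AroraBarak2009, OliveiraSanthanam2017, Literature.Barriers.PneNP.NaturalProofs.not_exists_naturalProof, Literature.Computability.Complexity.natural_proofs_barrier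
No combinatorial property of Boolean functions contains a P/poly-constructive, large sub-property
while being useful against n^k-size circuits for every k. Learning dictionary
[CarmosinoImpagliazzoKabanetsKolokolova2016, CCC 2016, Thm 1.1–1.3 (bib key missing)]: a
P/poly-natural property useful against P/poly ⇔ (up to quasi-polynomial slack) P/poly is learnable
under the uniform distribution with membership queries; in particular a polynomial-time PAC learner
for SIZE[n^k] (all k) yields such a property, so #4 ⇒ thesis. #4 follows from 2^{n^ε}-hard PRGs/PRFs
in P/poly [RazborovRudich1997, Thm 4.1 = Literature.Computability.Complexity.natural_proofs_barrier
read with its hypothesis discharged]. Companion of Circuit-route crux stmt-PneNP-0262 (MCSP ∉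
P/poly). [sources: RazborovRudich1997; CarmosinoImpagliazzoKabanetsKolokolova2016; arXiv:1611.01190]
[route PneNP/Learning, rank 4] -/
@[route_item "route-PneNP-Learning"]
def LearningNoNaturalProperty : Prop :=
  ¬ ∃ P : Literature.Computability.MetaComplexity.CombinatorialProperty, Literature.Computability.MetaComplexity.IsNatural Literature.Computability.Complexity.PPoly P ∧ Literature.Computability.MetaComplexity.IsUsefulAgainstPPoly P

/-- item stmt-PneNP-0419 · support · rank 5 · closed · proved by Summit.PneNP.PneNP.Theorems.learning_noNaturalPropertyImpliesPNeNP_proof @ ef4bcef9a285 (prover) · by planner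
sources: RazborovRudich1997, AroraBarak2009
If P = NP then Pₙ := {f : {0,1}ⁿ → {0,1} | circuitSizeOver B2 f > n^{⌊log₂ n⌋}} is a natural
property useful against P/poly: useful (n^{log n} > n^k eventually), large (Shannon counting: all
but a 2^{-Ω(2ⁿ)} fraction of f have complexity ≥ 2ⁿ/(2n) > n^{log n}), and its truth-table language
is in coNP (guess a circuit of size n^{log n} = N^{o(1)}, N = 2ⁿ, and evaluate on all N inputs) = P
⊆ P/poly (Literature.Computability.Complexity.P_subset_PPoly). Validates that #4 sits above the
problem. [RazborovRudich1997, §2 and Thm 4.1 discussion; AroraBarak2009, §23.1] [sources: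
RazborovRudich1997; AroraBarak2009] [route PneNP/Learning, rank 5] -/
@[route_item "route-PneNP-Learning"]
def LearningNoNaturalPropertyImpliesPNeNP : Prop :=
  (¬ ∃ P : Literature.Computability.MetaComplexity.CombinatorialProperty, Literature.Computability.MetaComplexity.IsNatural Literature.Computability.Complexity.PPoly P ∧ Literature.Computability.MetaComplexity.IsUsefulAgainstPPoly P) → Literature.Computability.Complexity.Classes.P ≠ Literature.Computability.Complexity.Nondeterministic.NP

/-- item stmt-PneNP-1156 · support · rank 6 · open · by planner
sources: BlumerEhrenfeuchtHausslerWarmuth1989, PittValiant1988, Valiant1984, AroraBarak2009, KearnsVazirani1994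
[support] Occam direction (KNOWN; it is the inline hypothesis no. 4 of the rev-1 route-closing item
and of Literature.Learning.learning_assembly, now tracked as an item): if Classes.P =
Nondeterministic.NP then every SIZE[n^k] = sizeClass B2 (n ↦ n^k) is polynomially PAC-predictable
(distribution-free, random examples). Print proof: draw m = ⌈(1/ε)(ln|SIZE_n[n^k]| + ln(1/δ))⌉ =
poly(n,1/ε,1/δ) examples (ln|SIZE_n[n^k]| = O(n^k log n): in-tree log2_ncard_sizeClass_B2_le); find
a size-≤n^k B₂-circuit consistent with the sample — NP search, poly-time under P = NP by
search-to-decision (in-tree exists_searchFn_of_NP_subset_P, exists_certificateFn_of_P_eq_NP =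
AroraBarak2009 Thm 2.18); output its code, evaluator = circuit evaluation; correctness = finite
Occam bound (in-tree occam_finite_consistent_holds; BEHW89 Thm 2.1(ii)(a), Cor 3.1.3;
PittValiant1988 p.968; Valiant1984 p.439). Formal work left: package sampler + FP search as ONE
poly-time OracleAlg with polynomial budgets in n+⌈1/ε⌉+⌈1/δ⌉ (k fixed first). Why it might fail:
only via model details of PolyPACPredictable, not mathematically. [sources:
BlumerEhrenfeuchtHausslerWarmuth1989; PittValiant1988; Valiant1984; AroraBarak2009 Th -/
@[route_item "route-PneNP-Learning", crux]
def LearningOccam : Prop :=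
  Literature.Computability.Complexity.Classes.P = Literature.Computability.Complexity.Nondeterministic.NP → ∀ k : ℕ, Literature.Computability.Learning.PolyPACPredictable Literature.Computability.Learning.allDistributions false (Literature.Computability.Learning.sizeClass Literature.Computability.Complexity.B2 (fun n => n ^ k))

/-- item stmt-PneNP-1160 · support · rank 7 · open · by planner
sources: KearnsVazirani1994, AroraBarak2009, Valiant1984
[support] glue crux #2 ⇒ target: if for some k the n^k-term DNF (the set in LearningDnfHard) are not
polynomially PAC-predictable then for some k' neither is SIZE[n^{k'}]. Proof in print (folklore;
KearnsVazirani1994 §1.2 representation size; AroraBarak2009 §6.1): a DNF φ with φ.length ≤ n^k terms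
computes, after shortening terms with repeated literals and dropping terms with complementary
literals (identically false under CNF.evalDNF), a function with a B₂-circuit of size ≤ c·n^{k+1} ≤
n^{k+2} for n ≥ n₀; so the DNF class ⊆ sizeClass B2 (n ↦ n^{k+2}) at every n ≥ n₀, predictability is
antitone in the class (PolyPACPredictable.mono), and the finitely many n < n₀ (where the inclusion
can fail, e.g. n = 0, 1) are absorbed into the learner: at fixed n the class is finite and an Occam
learner with brute-force consistency search is polynomial in ⌈1/ε⌉, ⌈1/δ⌉
(occam_finite_consistent_holds). Contrapositive gives the item. Why it might fail: only an encoding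
corner (CNF as List of List literals; patching one OracleAlg at finitely many n needs a case split)
— routine. [sources: KearnsVazirani1994 §1.2; AroraBarak2009 §6.1; Valiant1984] -/
@[route_item "route-PneNP-Learning"]
def LearningDnfHardImpliesThesis : Prop :=
  LearningDnfHard → LearningThesis

/-- item stmt-PneNP-1167 · support · rank 8 · open · by planner
sources: OliveiraSanthanam2017, CarmosinoImpagliazzoKabanetsKolokolova2016, RazborovRudich1997
[support] glue crux #4 ⇒ target (KNOWN: learning ⇒ natural property): if every SIZE[n^k] were
polynomially PAC-predictable (¬X; a fortiori under the uniform distribution) there would be a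
P/poly-natural property useful against P/poly. Print: OliveiraSanthanam2017 = arXiv:1611.01190 Lemma
5 (learners ⇒ distinguishers), Thm 8 (1)⇒(5); CIKK16 §1.1; RR97 §2. Sketch: amplify the learner of
SIZE[n^{k(n)}] (k(n) → ∞ slowly, run time ≤ 2^{O(n)}) to confidence 1−2^{-poly(n)} and fix
NON-UNIFORMLY one sample-and-coins string good for the whole class (union bound,
log2_ncard_sizeClass_B2_le); P_n := {f | that fixed run on f outputs h with #{x | h x ≠ f x} >
2^n/4}. Constructive: P.toLanguage ∈ PPoly (simulate the run on the truth table, count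
disagreements). Large: a run reads poly(n) bits of f, so ≤ 2^{poly(n)}·2^{H(1/4)2^n} ≤ 2^{2^n−1}
functions escape P_n (IsLarge, c = 1). Useful: once k(n) ≥ k every f ∈ SIZE[n^k] is learned, so f ∉
P_n (all k). Why it might fail: definitional mismatch only (IsLarge asks 2^{-O(n)} density,
IsConstructive is PPoly — both fit). [sources: OliveiraSanthanam2017 Lemma 5, Thm 8;
CarmosinoImpagliazzoKabanetsKolokolova2016 §1.1; RazborovRudich1997 §2] -/
@[route_item "route-PneNP-Learning"]
def LearningNoNaturalPropertyImpliesThesis : Prop :=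
  LearningNoNaturalProperty → LearningThesis

-- earlier Assembly (stmt-PneNP-0415, replaced 2026-08-15T16:22:27Z -> stmt-PneNP-10728): retired by None — Literature.Computability.Complexity.P_bool_eq → Literature.Computability.Complexity.NP_bool_eq → Literature.Computability.Complexity.P_subset_NP → (Literature.Computability.Complexity.Classes.P = Literature.Computability.Complexity.Nondeterministic.NP → ∀ k : ℕ, Literature.Computability.Learnin
/-- item stmt-PneNP-10728 · assembly · rank 1 · closed · proved by Summit.PneNP.PneNP.Theorems.learning_assembly_rev3_proof @ 99d40450dfc6 (prover) · by planner
[assembly] Assembly of route Learning (rev 3, restated): LearningOccam → LearningThesis → PneNP — if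
P = NP makes every SIZE[n^k] polynomially PAC-predictable (Occam, KNOWN) and some SIZE[n^k] is not
(the thesis X), then Cook's P ≠ NP. Hypotheses are listed items only; the model bridges P_bool_eq,
NP_bool_eq, P ⊆ NP are discharged INSIDE the proof, in a Theorems file:
`Literature.Learning.learning_assembly Literature.Computability.Complexity.P_bool_eq_holds
Literature.Computability.Complexity.NP_bool_eq_holds
Literature.Computability.Complexity.P_subset_NP_holds` (imports
Summits.PneNP.PneNP.Theorems.LearningAssembly,
Literature.Computability.Complexity.ClayProblemProofs,
Literature.Computability.Complexity.NondeterministicProofs; planner pre-check lean rc 0, axioms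
propext/Classical.choice/Quot.sound; candidate file attached as evidence). Provable now.
[BlumerEhrenfeuchtHausslerWarmuth1989, Thm 2.1; CookClay2006, §1; AroraBarakCC2009, Def. 2.1, Claim
2.4] [difficulty: provable-now] -/
@[route_item "route-PneNP-Learning", crux]
def Assembly : Prop :=
  LearningOccam → LearningThesis → PneNP

/-! D-0027 §2.1 — DECIDING THEOREM (planner-authored via `route open/edit --closes-file`; by planner-rbadge-PneNP-Learning-6b0ae876-g2-0 2026-08-15T16:22:27Z):
its hypotheses are this route's items and its conclusion the sub-problem Statement (glue_lint), and it elaborates with this file. -/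

@[closes "route-PneNP-Learning"] theorem closes (hX : LearningThesis) (hOccam : LearningOccam) (hA : Assembly) : _root_.PneNP :=
  hA hOccam hX

end Summit.PneNP.PneNP.Theses.Learning
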